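import Mathlib.Analysis.Calculus.MeanValue
import Literature.Analysis.FluidPDE.NewtonPotential
import HarnessLib

/-!
# The gradient potential of the far-field Newtonian kernel: smoothness and bounds

Analysis/FluidPDE support file on the discharge path of the named fact
`Literature.Analysis.FluidPDE.MajdaBertozzi2002_holderEulerLocalExistence`
(`ElgindiBlowupContinuationProofs.lean`; Lagrangian decomposition `HolderEulerLagrangian.lean`).
In the smooth near/far splitting `Γ = Γ₀ + Γ∞` of the Newtonian kernel (`NewtonKernel.lean`:
`Γ∞ = newtonFar r₀ r₁ = (1 − θ)Γ`, smooth, all derivatives up to order four bounded,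
`exists_bound_newtonFar_derivs`), the far part of the first-derivative potential
`∂_a(Γ ⋆ f)` of a compactly supported density `f : ℝ³ → F` is the harmless integral

  `T∞_a f (x) = ∫ ∂_aΓ∞(x − y) • f(y) dy`  (`newtonFarGradPotential r₀ r₁ a f x`),

a smooth kernel against an `L¹` density. This file proves what the Hölder theory of the full
potential (`NewtonGradientPotential*.lean`; Majda–Bertozzi, *Vorticity and Incompressible
Flow*, CUP 2002, §4.1.3 (4.38)–(4.39), p. 129 of the held text) needs from it:

* the kernels `newtonFarGrad r₀ r₁ a z = DΓ∞(z) a` and `newtonFarHess r₀ r₁ a b z = D²Γ∞(z) b a`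
  (smooth, bounded by `N₁‖a‖`, `N₂‖a‖‖b‖`, the latter `N₃‖a‖‖b‖`-Lipschitz,
  `fderiv (newtonFarGrad a) z b = newtonFarHess a b z`, symmetric);
* **differentiation under the integral for bounded-derivative kernels against compactly
  supported continuous densities** (`hasFDerivAt_integral_bddKernel_sub_smul`), the companion of
  `KernelSideDifferentiation.lean` (compactly supported kernels, arbitrary continuous densities);
* `hasFDerivAt_newtonFarGradPotential`, `fderiv_newtonFarGradPotential_apply`
  (`∂_b T∞_a f(x) = ∫ ∂_b∂_aΓ∞(x − y) • f(y) dy`), `contDiff_one_newtonFarGradPotential`, and the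
  bounds `‖T∞_a f(x)‖ ≤ N₁‖a‖ ∫‖f‖`, `‖D T∞_a f(x)‖ ≤ N₂‖a‖ ∫‖f‖`,
  `‖D T∞_a f(x) − D T∞_a f(x̄)‖ ≤ N₃‖a‖ |x − x̄| ∫‖f‖` (mean value theorem on the kernel).

## Mathlib / tree search

Tree (all used): `newtonFar`, `contDiff_newtonFar`, `exists_bound_newtonFar_derivs`
(`NewtonKernel`). Mathlib: `hasFDerivAt_integral_of_dominated_of_fderiv_le`,
`ContinuousLinearMap.integral_apply`, `norm_image_sub_le_of_norm_fderiv_le`,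
`norm_integral_le_of_norm_le`, `Continuous.integrable_of_hasCompactSupport`.

## References

* A. J. Majda, A. L. Bertozzi, *Vorticity and Incompressible Flow* (CUP 2002), §4.1.3
  (4.38)–(4.39), p. 129. [MajdaBertozziCUP2002]
* D. Gilbarg, N. S. Trudinger, *Elliptic Partial Differential Equations of Second Order*
  (2001), Lemma 4.1. [GilbargTrudinger2001]
-/

noncomputable section

open MeasureTheory Set Function Filter Metric Real
open _root_.Topology

namespace Literature.Analysis.FluidPDE

-- nested operator types `ℝ³ →L[ℝ] ℝ³ →L[ℝ] ℝ³ →L[ℝ] ℝ` (third derivatives)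
set_option maxSynthPendingDepth 3

/-- Local notation for physical space `ℝ³ = EuclideanSpace ℝ (Fin 3)`. -/
local notation "ℝ³" => EuclideanSpace ℝ (Fin 3)

variable {F : Type*} [NormedAddCommGroup F] [NormedSpace ℝ F]
variable {r₀ r₁ : ℝ}

/-! ### The far kernels -/

/-- **The far gradient kernel** `∂_aΓ∞(z) = DΓ∞(z) a` (smooth, bounded). [folklore] -/
def newtonFarGrad (r₀ r₁ : ℝ) (a z : ℝ³) : ℝ :=
  fderiv ℝ (newtonFar r₀ r₁) z a

/-- **The far Hessian kernel** `∂_b∂_aΓ∞(z) = D²Γ∞(z) b a` (smooth, bounded, Lipschitz). [folklore] -/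
def newtonFarHess (r₀ r₁ : ℝ) (a b z : ℝ³) : ℝ :=
  fderiv ℝ (fderiv ℝ (newtonFar r₀ r₁)) z b a

/-- `∂_aΓ∞` is smooth. [folklore] -/
theorem contDiff_newtonFarGrad (h₀ : 0 < r₀) (h₁ : r₀ < r₁) (a : ℝ³) {n : ℕ∞} :
    ContDiff ℝ n (newtonFarGrad r₀ r₁ a) :=
  ((contDiff_newtonFar h₀ h₁ (n := n + 1)).fderiv_right (m := n) le_rfl).clm_apply contDiff_const

/-- `∂_b∂_aΓ∞` is smooth. [folklore] -/
theorem contDiff_newtonFarHess (h₀ : 0 < r₀) (h₁ : r₀ < r₁) (a b : ℝ³) {n : ℕ∞} :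
    ContDiff ℝ n (newtonFarHess r₀ r₁ a b) :=
  ((((contDiff_newtonFar h₀ h₁ (n := n + 1 + 1)).fderiv_right (m := n + 1)
    (by exact_mod_cast le_rfl)).fderiv_right (m := n) (by exact_mod_cast le_rfl)).clm_apply
    contDiff_const).clm_apply contDiff_const

/-- `D(∂_aΓ∞)(z) b = ∂_b∂_aΓ∞(z)`. [folklore] -/
theorem hasFDerivAt_newtonFarGrad (h₀ : 0 < r₀) (h₁ : r₀ < r₁) (a z : ℝ³) :
    HasFDerivAt (newtonFarGrad r₀ r₁ a) ((fderiv ℝ (fderiv ℝ (newtonFar r₀ r₁)) z).flip a) z := by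
  have hd : HasFDerivAt (fderiv ℝ (newtonFar r₀ r₁)) (fderiv ℝ (fderiv ℝ (newtonFar r₀ r₁)) z) z :=
    (((contDiff_newtonFar h₀ h₁ (n := 2)).fderiv_right (m := 1) le_rfl).differentiable
      one_ne_zero z).hasFDerivAt
  have h := hd.clm_apply (hasFDerivAt_const a z)
  rw [ContinuousLinearMap.comp_zero, zero_add] at h
  exact h

/-- `fderiv (∂_aΓ∞) z b = ∂_b∂_aΓ∞(z)`. [folklore] -/
theorem fderiv_newtonFarGrad_apply (h₀ : 0 < r₀) (h₁ : r₀ < r₁) (a b z : ℝ³) :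
    fderiv ℝ (newtonFarGrad r₀ r₁ a) z b = newtonFarHess r₀ r₁ a b z := by
  rw [(hasFDerivAt_newtonFarGrad h₀ h₁ a z).fderiv, ContinuousLinearMap.flip_apply, newtonFarHess]

/-- `∂_b∂_aΓ∞ = ∂_a∂_bΓ∞` (symmetry of second derivatives of a `C²` function). [folklore] -/
theorem newtonFarHess_comm (h₀ : 0 < r₀) (h₁ : r₀ < r₁) (a b z : ℝ³) :
    newtonFarHess r₀ r₁ a b z = newtonFarHess r₀ r₁ b a z := by
  have hs := ((contDiff_newtonFar h₀ h₁ (n := 2)).contDiffAt (x := z)).isSymmSndFDerivAt (by simp)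
  rw [newtonFarHess, newtonFarHess]
  exact hs b a

/-- The derivative of `∂_b∂_aΓ∞` in terms of `D³Γ∞`. [folklore] -/
theorem hasFDerivAt_newtonFarHess (h₀ : 0 < r₀) (h₁ : r₀ < r₁) (a b z : ℝ³) :
    HasFDerivAt (newtonFarHess r₀ r₁ a b)
      (((fderiv ℝ (fderiv ℝ (fderiv ℝ (newtonFar r₀ r₁))) z).flip b).flip a) z := by
  have hd : HasFDerivAt (fderiv ℝ (fderiv ℝ (newtonFar r₀ r₁)))
      (fderiv ℝ (fderiv ℝ (fderiv ℝ (newtonFar r₀ r₁))) z) z :=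
    ((((contDiff_newtonFar h₀ h₁ (n := 3)).fderiv_right (m := 2) (by norm_num)).fderiv_right
      (m := 1) le_rfl).differentiable one_ne_zero z).hasFDerivAt
  have h1 := hd.clm_apply (hasFDerivAt_const b z)
  rw [ContinuousLinearMap.comp_zero, zero_add] at h1
  have h2 := h1.clm_apply (hasFDerivAt_const a z)
  rw [ContinuousLinearMap.comp_zero, zero_add] at h2
  exact h2

/-- **Bounds for the far kernels**: `|∂_aΓ∞| ≤ N₁‖a‖`, `|∂_b∂_aΓ∞| ≤ N₂‖a‖‖b‖`,
`‖D(∂_aΓ∞)‖ ≤ N₂‖a‖`, `‖D(∂_b∂_aΓ∞)‖ ≤ N₃‖a‖‖b‖`, `‖D(D ∂_aΓ∞)‖ ≤ N₃‖a‖`. [folklore] -/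
theorem exists_bounds_newtonFarGrad (h₀ : 0 < r₀) (h₁ : r₀ < r₁) :
    ∃ N₁ N₂ N₃ : ℝ, 0 ≤ N₁ ∧ 0 ≤ N₂ ∧ 0 ≤ N₃ ∧
      (∀ a z : ℝ³, |newtonFarGrad r₀ r₁ a z| ≤ N₁ * ‖a‖) ∧
      (∀ a b z : ℝ³, |newtonFarHess r₀ r₁ a b z| ≤ N₂ * ‖a‖ * ‖b‖) ∧
      (∀ a z : ℝ³, ‖fderiv ℝ (newtonFarGrad r₀ r₁ a) z‖ ≤ N₂ * ‖a‖) ∧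
      (∀ a b z : ℝ³, ‖fderiv ℝ (newtonFarHess r₀ r₁ a b) z‖ ≤ N₃ * ‖a‖ * ‖b‖) ∧
      ∀ a z : ℝ³, ‖fderiv ℝ (fderiv ℝ (newtonFarGrad r₀ r₁ a)) z‖ ≤ N₃ * ‖a‖ := by
  obtain ⟨-, ⟨N₁, hN₁⟩, ⟨N₂, hN₂⟩, ⟨N₃, hN₃⟩, -⟩ := exists_bound_newtonFar_derivs h₀ h₁
  have hN₁0 : 0 ≤ N₁ := (norm_nonneg _).trans (hN₁ 0)
  have hN₂0 : 0 ≤ N₂ := (norm_nonneg _).trans (hN₂ 0)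
  have hN₃0 : 0 ≤ N₃ := (norm_nonneg _).trans (hN₃ 0)
  -- the derivative of `∂_aΓ∞` as a function is `(D²Γ∞ ·).flip a`
  have hD1 : ∀ a : ℝ³, fderiv ℝ (newtonFarGrad r₀ r₁ a) =
      fun z => (fderiv ℝ (fderiv ℝ (newtonFar r₀ r₁)) z).flip a := fun a =>
    funext fun z => (hasFDerivAt_newtonFarGrad h₀ h₁ a z).fderiv
  refine ⟨N₁, N₂, N₃, hN₁0, hN₂0, hN₃0, fun a z => ?_, fun a b z => ?_, fun a z => ?_,
    fun a b z => ?_, fun a z => ?_⟩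
  · rw [newtonFarGrad, ← Real.norm_eq_abs]
    exact (ContinuousLinearMap.le_opNorm _ _).trans (mul_le_mul_of_nonneg_right (hN₁ z)
      (norm_nonneg _))
  · rw [newtonFarHess, ← Real.norm_eq_abs]
    set L := fderiv ℝ (fderiv ℝ (newtonFar r₀ r₁)) z
    calc ‖L b a‖ ≤ ‖L b‖ * ‖a‖ := ContinuousLinearMap.le_opNorm _ _
      _ ≤ ‖L‖ * ‖b‖ * ‖a‖ := mul_le_mul_of_nonneg_right (L.le_opNorm b) (norm_nonneg _)
      _ ≤ N₂ * ‖b‖ * ‖a‖ := by gcongr; exact hN₂ z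
      _ = N₂ * ‖a‖ * ‖b‖ := by ring
  · rw [hD1 a]
    set L := fderiv ℝ (fderiv ℝ (newtonFar r₀ r₁)) z
    calc ‖L.flip a‖ ≤ ‖L.flip‖ * ‖a‖ := ContinuousLinearMap.le_opNorm _ _
      _ = ‖L‖ * ‖a‖ := by rw [ContinuousLinearMap.opNorm_flip]
      _ ≤ N₂ * ‖a‖ := mul_le_mul_of_nonneg_right (hN₂ z) (norm_nonneg _)
  · rw [(hasFDerivAt_newtonFarHess h₀ h₁ a b z).fderiv]
    set L := fderiv ℝ (fderiv ℝ (fderiv ℝ (newtonFar r₀ r₁))) z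
    calc ‖(L.flip b).flip a‖ ≤ ‖(L.flip b).flip‖ * ‖a‖ := ContinuousLinearMap.le_opNorm _ _
      _ = ‖L.flip b‖ * ‖a‖ := by rw [ContinuousLinearMap.opNorm_flip]
      _ ≤ ‖L.flip‖ * ‖b‖ * ‖a‖ :=
          mul_le_mul_of_nonneg_right (L.flip.le_opNorm b) (norm_nonneg _)
      _ = ‖L‖ * ‖b‖ * ‖a‖ := by rw [ContinuousLinearMap.opNorm_flip]
      _ ≤ N₃ * ‖b‖ * ‖a‖ := by gcongr; exact hN₃ z
      _ = N₃ * ‖a‖ * ‖b‖ := by ring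
  · -- `D(D ∂_aΓ∞) = D((D²Γ∞ ·).flip a) = (flipping) ∘ D³Γ∞`
    rw [hD1 a]
    have hd : HasFDerivAt (fderiv ℝ (fderiv ℝ (newtonFar r₀ r₁)))
        (fderiv ℝ (fderiv ℝ (fderiv ℝ (newtonFar r₀ r₁))) z) z :=
      ((((contDiff_newtonFar h₀ h₁ (n := 3)).fderiv_right (m := 2) (by norm_num)).fderiv_right
        (m := 1) le_rfl).differentiable one_ne_zero z).hasFDerivAt
    -- flipping in the last two arguments and evaluating at `a` is a continuous linear map `Φ`
    set Φ : (ℝ³ →L[ℝ] ℝ³ →L[ℝ] ℝ) →L[ℝ] (ℝ³ →L[ℝ] ℝ) :=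
      (ContinuousLinearMap.apply ℝ (ℝ³ →L[ℝ] ℝ) a).comp
        (ContinuousLinearMap.flipₗᵢ ℝ ℝ³ ℝ³ ℝ).toContinuousLinearEquiv.toContinuousLinearMap
      with hΦ
    have hΦapply : ∀ L : ℝ³ →L[ℝ] ℝ³ →L[ℝ] ℝ, Φ L = L.flip a := fun L => rfl
    have hΦnorm : ‖Φ‖ ≤ ‖a‖ := by
      refine ContinuousLinearMap.opNorm_le_bound _ (norm_nonneg _) fun L => ?_
      rw [hΦapply]
      calc ‖L.flip a‖ ≤ ‖L.flip‖ * ‖a‖ := ContinuousLinearMap.le_opNorm _ _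
        _ = ‖a‖ * ‖L‖ := by rw [ContinuousLinearMap.opNorm_flip, mul_comm]
    have heq : (fun z => (fderiv ℝ (fderiv ℝ (newtonFar r₀ r₁)) z).flip a) =
        ⇑Φ ∘ fderiv ℝ (fderiv ℝ (newtonFar r₀ r₁)) := by
      funext w; rw [Function.comp_apply, hΦapply]
    rw [heq, (Φ.hasFDerivAt.comp z hd).fderiv]
    calc ‖Φ.comp (fderiv ℝ (fderiv ℝ (fderiv ℝ (newtonFar r₀ r₁))) z)‖
        ≤ ‖Φ‖ * ‖fderiv ℝ (fderiv ℝ (fderiv ℝ (newtonFar r₀ r₁))) z‖ :=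
          ContinuousLinearMap.opNorm_comp_le _ _
      _ ≤ ‖a‖ * N₃ := mul_le_mul hΦnorm (hN₃ z) (norm_nonneg _) (norm_nonneg _)
      _ = N₃ * ‖a‖ := mul_comm _ _

/-- **Lipschitz bounds** for `∂_b∂_aΓ∞` and for `D(∂_aΓ∞)` (mean value theorem on `ℝ³`). [folklore] -/
theorem norm_newtonFarHess_sub_le (h₀ : 0 < r₀) (h₁ : r₀ < r₁) {N₃ : ℝ}
    (hN₃ : ∀ a b z : ℝ³, ‖fderiv ℝ (newtonFarHess r₀ r₁ a b) z‖ ≤ N₃ * ‖a‖ * ‖b‖) (a b w w' : ℝ³) :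
    |newtonFarHess r₀ r₁ a b w - newtonFarHess r₀ r₁ a b w'| ≤ N₃ * ‖a‖ * ‖b‖ * ‖w - w'‖ := by
  rw [← Real.norm_eq_abs]
  exact (convex_univ).norm_image_sub_le_of_norm_fderiv_le
    (fun z _ => ((contDiff_newtonFarHess h₀ h₁ a b (n := 1)).differentiable one_ne_zero z))
    (fun z _ => hN₃ a b z) (mem_univ w') (mem_univ w)

/-- Lipschitz bound for the `CLM`-valued derivative `D(∂_aΓ∞)`. [folklore] -/
theorem norm_fderiv_newtonFarGrad_sub_le (h₀ : 0 < r₀) (h₁ : r₀ < r₁) {N₃ : ℝ}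
    (hN₃ : ∀ a z : ℝ³, ‖fderiv ℝ (fderiv ℝ (newtonFarGrad r₀ r₁ a)) z‖ ≤ N₃ * ‖a‖) (a w w' : ℝ³) :
    ‖fderiv ℝ (newtonFarGrad r₀ r₁ a) w - fderiv ℝ (newtonFarGrad r₀ r₁ a) w'‖ ≤
      N₃ * ‖a‖ * ‖w - w'‖ :=
  (convex_univ).norm_image_sub_le_of_norm_fderiv_le
    (fun z _ => (((contDiff_newtonFarGrad h₀ h₁ a (n := 2)).fderiv_right (m := 1)
      le_rfl).differentiable one_ne_zero z))
    (fun z _ => hN₃ a z) (mem_univ w') (mem_univ w)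

/-! ### Differentiation under the integral: bounded-derivative kernels, compactly supported densities -/

/-- **Differentiation under the integral sign, kernel side, for kernels with bounded derivative
and compactly supported continuous densities**: for `k ∈ C¹(ℝ³; ℝ)` with `‖Dk‖ ≤ D` and
`g : ℝ³ → F` continuous with compact support, `x ↦ ∫ k(x − y) • g(y) dy` has derivative
`∫ Dk(x₀ − y)(·) • g(y) dy` at `x₀` (dominated convergence with the bound `D‖g(y)‖`). [folklore] -/
theorem hasFDerivAt_integral_bddKernel_sub_smul {k : ℝ³ → ℝ} (hk : ContDiff ℝ 1 k) {D : ℝ}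
    (hD : ∀ z, ‖fderiv ℝ k z‖ ≤ D) {g : ℝ³ → F} (hg : Continuous g) (hgc : HasCompactSupport g)
    (x₀ : ℝ³) :
    HasFDerivAt (fun x => ∫ y, k (x - y) • g y)
      (∫ y, (fderiv ℝ k (x₀ - y)).smulRight (g y)) x₀ := by
  have hkcont : Continuous k := hk.continuous
  have hDk : Continuous (fderiv ℝ k) := hk.continuous_fderiv one_ne_zero
  have hD0 : 0 ≤ D := (norm_nonneg _).trans (hD 0)
  refine hasFDerivAt_integral_of_dominated_of_fderiv_le
    (F' := fun x y => (fderiv ℝ k (x - y)).smulRight (g y))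
    (bound := fun y => D * ‖g y‖) (ball_mem_nhds x₀ zero_lt_one) ?_ ?_ ?_ ?_ ?_ ?_
  · exact Eventually.of_forall fun x =>
      ((hkcont.comp (continuous_const.sub continuous_id)).smul hg).aestronglyMeasurable
  · exact ((hkcont.comp (continuous_const.sub continuous_id)).smul hg).integrable_of_hasCompactSupport
      hgc.smul_left
  · exact (((ContinuousLinearMap.smulRightL ℝ ℝ³ F).continuous₂).comp₂
      (hDk.comp (continuous_const.sub continuous_id)) hg).aestronglyMeasurable
  · refine Eventually.of_forall fun y x _ => ?_
    rw [ContinuousLinearMap.norm_smulRight_apply]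
    exact mul_le_mul_of_nonneg_right (hD _) (norm_nonneg _)
  · exact (hg.norm.integrable_of_hasCompactSupport hgc.norm).const_mul D
  · refine Eventually.of_forall fun y x _ => ?_
    have h1 : HasFDerivAt (fun x : ℝ³ => k (x - y)) (fderiv ℝ k (x - y)) x := by
      have := ((hk.differentiable one_ne_zero) (x - y)).hasFDerivAt.comp x (hasFDerivAt_sub_const y)
      rwa [ContinuousLinearMap.comp_id] at this
    exact h1.smul_const (g y)

/-- A continuous kernel against a continuous compactly supported density through a bilinear
map: `y ↦ B (k(x − y)) (g y)` is integrable (continuous with compact support). [folklore] -/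
theorem integrable_bilin_kernel_sub_of_hasCompactSupport {W : Type*} [NormedAddCommGroup W]
    [NormedSpace ℝ W] {V : Type*} [NormedAddCommGroup V] [NormedSpace ℝ V] {k : ℝ³ → W}
    (hk : Continuous k) (B : W →L[ℝ] F →L[ℝ] V) {g : ℝ³ → F} (hg : Continuous g)
    (hgc : HasCompactSupport g) (x : ℝ³) : Integrable fun y => B (k (x - y)) (g y) := by
  refine Continuous.integrable_of_hasCompactSupport
    (B.continuous₂.comp₂ (hk.comp (continuous_const.sub continuous_id)) hg) ?_
  refine hgc.mono fun y hy => ?_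
  rw [mem_support] at hy ⊢
  intro h0
  exact hy (by rw [h0, map_zero])

/-- The directional form:
`∂_b ∫ k(x − y) • g(y) dy = ∫ (Dk(x − y) b) • g(y) dy`. [folklore] -/
theorem fderiv_integral_bddKernel_sub_smul_apply [CompleteSpace F] {k : ℝ³ → ℝ}
    (hk : ContDiff ℝ 1 k) {D : ℝ} (hD : ∀ z, ‖fderiv ℝ k z‖ ≤ D) {g : ℝ³ → F} (hg : Continuous g)
    (hgc : HasCompactSupport g) (x b : ℝ³) :
    fderiv ℝ (fun x => ∫ y, k (x - y) • g y) x b = ∫ y, (fderiv ℝ k (x - y) b) • g y := by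
  rw [(hasFDerivAt_integral_bddKernel_sub_smul hk hD hg hgc x).fderiv,
    ContinuousLinearMap.integral_apply]
  · rfl
  · exact integrable_bilin_kernel_sub_of_hasCompactSupport (hk.continuous_fderiv one_ne_zero)
      (ContinuousLinearMap.smulRightL ℝ ℝ³ F) hg hgc x

/-! ### The far gradient potential -/

/-- **The far gradient potential** `T∞_a f (x) = ∫ ∂_aΓ∞(x − y) • f(y) dy` — the far part of
`∂_a(Γ ⋆ f)` in the splitting `Γ = Γ₀ + Γ∞`; a smooth kernel against the density, so all its
regularity is that of `Γ∞` (Majda–Bertozzi's far-field pieces in the proof of Lemma 4.6,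
p. 144: the integration over `|x − x'| ≥ R` against bounded kernels). Bochner integral; it
converges for continuous compactly supported `f`. [cite: MajdaBertozziCUP2002, §4.5 proof of Lemma 4.6 (p. 144), far-field pieces] -/
def newtonFarGradPotential (r₀ r₁ : ℝ) (a : ℝ³) (f : ℝ³ → F) (x : ℝ³) : F :=
  ∫ y, newtonFarGrad r₀ r₁ a (x - y) • f y

section Far

/-- **The far gradient potential is differentiable**, with derivative
`∫ D(∂_aΓ∞)(x − y)(·) • f(y) dy`. [folklore] -/
theorem hasFDerivAt_newtonFarGradPotential (h₀ : 0 < r₀) (h₁ : r₀ < r₁) (a : ℝ³) {f : ℝ³ → F}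
    (hf : Continuous f) (hfc : HasCompactSupport f) (x : ℝ³) :
    HasFDerivAt (newtonFarGradPotential r₀ r₁ a f)
      (∫ y, (fderiv ℝ (newtonFarGrad r₀ r₁ a) (x - y)).smulRight (f y)) x := by
  obtain ⟨N₁, N₂, N₃, -, -, -, -, -, hD, -, -⟩ := exists_bounds_newtonFarGrad h₀ h₁
  exact hasFDerivAt_integral_bddKernel_sub_smul (contDiff_newtonFarGrad h₀ h₁ a) (hD a) hf hfc x

/-- `∂_b T∞_a f(x) = ∫ ∂_b∂_aΓ∞(x − y) • f(y) dy`. [folklore] -/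
theorem fderiv_newtonFarGradPotential_apply [CompleteSpace F] (h₀ : 0 < r₀) (h₁ : r₀ < r₁)
    (a : ℝ³) {f : ℝ³ → F}
    (hf : Continuous f) (hfc : HasCompactSupport f) (x b : ℝ³) :
    fderiv ℝ (newtonFarGradPotential r₀ r₁ a f) x b =
      ∫ y, newtonFarHess r₀ r₁ a b (x - y) • f y := by
  obtain ⟨N₁, N₂, N₃, -, -, -, -, -, hD, -, -⟩ := exists_bounds_newtonFarGrad h₀ h₁
  have h := fderiv_integral_bddKernel_sub_smul_apply (contDiff_newtonFarGrad h₀ h₁ a) (hD a) hf hfc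
    x b
  have e : newtonFarGradPotential r₀ r₁ a f = fun x => ∫ y, newtonFarGrad r₀ r₁ a (x - y) • f y :=
    rfl
  rw [e, h]
  refine integral_congr_ae (Eventually.of_forall fun y => ?_)
  show fderiv ℝ (newtonFarGrad r₀ r₁ a) (x - y) b • f y = newtonFarHess r₀ r₁ a b (x - y) • f y
  rw [fderiv_newtonFarGrad_apply h₀ h₁]

/-- `∫ ‖f‖` controls integrals of `f` against bounded weights: if `|w| ≤ N` then
`‖∫ w(y) • f(y) dy‖ ≤ N ∫ ‖f‖`. [folklore] -/
theorem norm_integral_smul_le_of_abs_le {w : ℝ³ → ℝ} {N : ℝ} (hw : ∀ y, |w y| ≤ N) {f : ℝ³ → F}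
    (hf : Continuous f) (hfc : HasCompactSupport f) :
    ‖∫ y, w y • f y‖ ≤ N * ∫ y, ‖f y‖ := by
  rw [← integral_const_mul]
  refine norm_integral_le_of_norm_le ((hf.norm.integrable_of_hasCompactSupport hfc.norm).const_mul N)
    (Eventually.of_forall fun y => ?_)
  rw [norm_smul, Real.norm_eq_abs]
  exact mul_le_mul_of_nonneg_right (hw y) (norm_nonneg _)

/-- **Bounds for the far gradient potential**: there are `N₁, N₂, N₃ = N(r₀, r₁)` with
`‖T∞_a f(x)‖ ≤ N₁‖a‖ ∫‖f‖`, `‖D T∞_a f(x)‖ ≤ N₂‖a‖ ∫‖f‖` and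
`‖D T∞_a f(x) − D T∞_a f(x̄)‖ ≤ N₃‖a‖ |x − x̄| ∫‖f‖` for all continuous compactly supported
`f` (the far-field pieces of Majda–Bertozzi's (4.38)–(4.39)). [cite: MajdaBertozziCUP2002, §4.1.3 (4.38)–(4.39) (p. 129)] -/
theorem exists_newtonFarGradPotential_bounds (h₀ : 0 < r₀) (h₁ : r₀ < r₁) :
    ∃ N₁ N₂ N₃ : ℝ, 0 ≤ N₁ ∧ 0 ≤ N₂ ∧ 0 ≤ N₃ ∧ ∀ (a : ℝ³) (f : ℝ³ → F), Continuous f →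
      HasCompactSupport f →
      (∀ x, ‖newtonFarGradPotential r₀ r₁ a f x‖ ≤ N₁ * ‖a‖ * ∫ y, ‖f y‖) ∧
      (∀ x, ‖fderiv ℝ (newtonFarGradPotential r₀ r₁ a f) x‖ ≤ N₂ * ‖a‖ * ∫ y, ‖f y‖) ∧
      ∀ x x', ‖fderiv ℝ (newtonFarGradPotential r₀ r₁ a f) x -
          fderiv ℝ (newtonFarGradPotential r₀ r₁ a f) x'‖ ≤ N₃ * ‖a‖ * ‖x - x'‖ * ∫ y, ‖f y‖ := by
  obtain ⟨N₁, N₂, N₃, hN₁0, hN₂0, hN₃0, hG, -, hDG, -, hDDG⟩ := exists_bounds_newtonFarGrad h₀ h₁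
  refine ⟨N₁, N₂, N₃, hN₁0, hN₂0, hN₃0, fun a f hf hfc => ⟨fun x => ?_, fun x => ?_, fun x x' => ?_⟩⟩
  · exact norm_integral_smul_le_of_abs_le (fun y => hG a (x - y)) hf hfc
  · rw [(hasFDerivAt_newtonFarGradPotential h₀ h₁ a hf hfc x).fderiv, ← integral_const_mul]
    refine norm_integral_le_of_norm_le
      ((hf.norm.integrable_of_hasCompactSupport hfc.norm).const_mul _)
      (Eventually.of_forall fun y => ?_)
    rw [ContinuousLinearMap.norm_smulRight_apply]
    exact mul_le_mul_of_nonneg_right (hDG a (x - y)) (norm_nonneg _)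
  · have hI : ∀ x, Integrable fun y => (fderiv ℝ (newtonFarGrad r₀ r₁ a) (x - y)).smulRight (f y) :=
      fun x => integrable_bilin_kernel_sub_of_hasCompactSupport
        ((contDiff_newtonFarGrad h₀ h₁ a (n := 1)).continuous_fderiv one_ne_zero)
        (ContinuousLinearMap.smulRightL ℝ ℝ³ F) hf hfc x
    rw [(hasFDerivAt_newtonFarGradPotential h₀ h₁ a hf hfc x).fderiv,
      (hasFDerivAt_newtonFarGradPotential h₀ h₁ a hf hfc x').fderiv, ← integral_sub (hI x) (hI x'),
      ← integral_const_mul]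
    refine norm_integral_le_of_norm_le
      ((hf.norm.integrable_of_hasCompactSupport hfc.norm).const_mul _)
      (Eventually.of_forall fun y => ?_)
    show ‖(fderiv ℝ (newtonFarGrad r₀ r₁ a) (x - y)).smulRight (f y) -
      (fderiv ℝ (newtonFarGrad r₀ r₁ a) (x' - y)).smulRight (f y)‖ ≤ N₃ * ‖a‖ * ‖x - x'‖ * ‖f y‖
    have e : (fderiv ℝ (newtonFarGrad r₀ r₁ a) (x - y)).smulRight (f y) -
        (fderiv ℝ (newtonFarGrad r₀ r₁ a) (x' - y)).smulRight (f y) =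
        (fderiv ℝ (newtonFarGrad r₀ r₁ a) (x - y) -
          fderiv ℝ (newtonFarGrad r₀ r₁ a) (x' - y)).smulRight (f y) := by
      ext v
      simp [sub_smul]
    rw [e, ContinuousLinearMap.norm_smulRight_apply]
    calc ‖fderiv ℝ (newtonFarGrad r₀ r₁ a) (x - y) - fderiv ℝ (newtonFarGrad r₀ r₁ a) (x' - y)‖ *
          ‖f y‖
        ≤ (N₃ * ‖a‖ * ‖(x - y) - (x' - y)‖) * ‖f y‖ :=
          mul_le_mul_of_nonneg_right (norm_fderiv_newtonFarGrad_sub_le h₀ h₁ hDDG a _ _)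
            (norm_nonneg _)
      _ = N₃ * ‖a‖ * ‖x - x'‖ * ‖f y‖ := by rw [show x - y - (x' - y) = x - x' by abel]

/-- **The far gradient potential of a continuous compactly supported density is `C¹`** (its
derivative is even Lipschitz, `exists_newtonFarGradPotential_bounds`). [folklore] -/
theorem contDiff_one_newtonFarGradPotential (h₀ : 0 < r₀) (h₁ : r₀ < r₁) (a : ℝ³) {f : ℝ³ → F}
    (hf : Continuous f) (hfc : HasCompactSupport f) :
    ContDiff ℝ 1 (newtonFarGradPotential r₀ r₁ a f) := by
  obtain ⟨N₁, N₂, N₃, -, -, hN₃0, hB⟩ := exists_newtonFarGradPotential_bounds (F := F) h₀ h₁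
  obtain ⟨-, -, hLip⟩ := hB a f hf hfc
  have hI0 : 0 ≤ ∫ y, ‖f y‖ := integral_nonneg fun _ => norm_nonneg _
  have hK0 : 0 ≤ N₃ * ‖a‖ * ∫ y, ‖f y‖ := by positivity
  have hL : LipschitzWith (Real.toNNReal (N₃ * ‖a‖ * ∫ y, ‖f y‖))
      (fderiv ℝ (newtonFarGradPotential r₀ r₁ a f)) := by
    refine LipschitzWith.of_dist_le_mul fun x x' => ?_
    rw [dist_eq_norm, dist_eq_norm, Real.coe_toNNReal _ hK0]
    calc ‖fderiv ℝ (newtonFarGradPotential r₀ r₁ a f) x -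
          fderiv ℝ (newtonFarGradPotential r₀ r₁ a f) x'‖
        ≤ N₃ * ‖a‖ * ‖x - x'‖ * ∫ y, ‖f y‖ := hLip x x'
      _ = N₃ * ‖a‖ * (∫ y, ‖f y‖) * ‖x - x'‖ := by ring
  rw [contDiff_one_iff_fderiv]
  exact ⟨fun x => (hasFDerivAt_newtonFarGradPotential h₀ h₁ a hf hfc x).differentiableAt,
    hL.continuous⟩

end Far

end Literature.Analysis.FluidPDE
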